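import Summits.HodgeConjecture.HodgeConjecture.Theorems.Ring2AbelianAllAndreInvariantHodgeTypes
import Literature.AlgebraicGeometry.HodgeTheory.AlgebraicClassesCupDivisorHolds
import HarnessLib

/-!
# Ring 2 · sub-cell AbelianAll (ALL ABELIAN VARIETIES), André axis, part XVI-e — (β′_f) OUTRIGHT for every compact
# pencil whose invariant cohomology is GENERATED IN DEGREE 2 and on which no (2,0)-class of the total space
# survives on a fibre (generalises part XV-f's rank-one / Lefschetz-generic theorem to invariant rings generated by
# several degree-2 classes: fibre products of generic pencils, `Sp × ⋯ × Sp` monodromy, …)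

HONEST FRAMING (page 1, verbatim): **research route, not a corollary; conditional on HC_CM plus one named
minimal statement.** Cell line: research route conditional on HC_CM; not a corollary; Q11.4-sentence-2
already refuted in dim ≥ 3. Nothing in this file proves a case of the Hodge conjecture for an abelian variety.
`HC_CM` = `Theses.RankFourFaces.CMAbelianHodge` does not occur in this file; item `Theses.RankFourFaces.CMToAbelian`
(stmt-16267) OPEN and not closed here. Seat `pub-hodge-ring2-ab-andre-2`, gen 8.

## What is proved (theorems only; no definition, no named fact, no sorry)

For a compact pencil `f : 𝒳 ⟶ S` of abelian `d`-folds and a fibre `t₀`, write `I_{2p}(t₀) = j_{t₀}^* H²ᵖ(𝒳(ℂ); ℂ)`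
and say that **`I_{2(p+1)}(t₀)` is generated by `I_{2p}(t₀)` and `I₂(t₀)`** if every class of `I_{2(p+1)}(t₀)` is a
`ℂ`-linear combination of restrictions `j_{t₀}^*(W ∪ D)`, `W ∈ H²ᵖ(𝒳)`, `D ∈ H²(𝒳)` (a HYPOTHESIS, stated inline;
in print: the monodromy-invariant subring of `H^{2•}(𝒳_{t₀})` is generated in degree 2 — true for monodromy
Zariski-dense in `Sp_{2d}` (rank one, part XV-f), in `Sp × ⋯ × Sp` (fibre products of such pencils), …).

* **`algebraicInvariantClassesAt_succ_of_generated`** — (N_p)(t₀) ∧ (N₁)(t₀) ∧ "`I_{2(p+1)}` generated by `I_{2p}`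
  and `I₂`" ⟹ (N_{p+1})(t₀): lift `W` and `D` to algebraic classes `A`, `B` with the same restrictions (the
  hypotheses) and use `A ∪ B ∈ N^{p+1}(𝒳)` — a CYCLE times a DIVISOR is algebraic on every smooth projective
  variety, the tree's `cupProduct_mem_algebraicClasses_one_right` (Voisin II Prop. 9.20 via Deligne Hodge III
  8.2.8; no moving lemma) — and `j^*(A ∪ B) = j^*A ∪ j^*B`.
* **`algebraicInvariantClassesAt_of_generated`** — (N₁)(t₀) ∧ generation in all degrees `2 ≤ 2(p+1) ≤ 2P` ⟹
  (N_p)(t₀) for all `p ≤ P` (induction; (N₀) is free).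
* **`fibreClassLefschetzOn_of_generated`** — (β′_f) for every compact pencil with (N₁)(t₀) (divisor-spanned
  invariant `H²`) whose invariant classes in degrees `4 ≤ 2(p+1) ≤ d` are generated by the previous degree and
  degree 2 (part XIV-g: the degrees `2p ≤ d` suffice).
* **`fibreClassLefschetzOn_of_generated_of_twoZero_vanish`** — the same with (N₁)(t₀) replaced by the
  TOTAL-SPACE condition of part XVI-a: no class of type `(2,0)` of `𝒳` survives on `𝒳_{t₀}` (e.g.
  `h^{2,0}(𝒳) = 0`, `fibreClassLefschetzOn_of_generated_of_twoZero_eq_zero`); `invariantCyclesHoldFor_…` twin.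

READING (RING2-MAP §AbelianAll gen 8). WHERE (β′) IS OPEN, SHARPENED (supersedes AA2.59's sentence): the
Lefschetz-type B_min of this axis is a THEOREM on every compact pencil whose invariant ring (degrees `≤ d`) is
generated in degree 2 and whose total space has no holomorphic 2-form class surviving on a fibre; it is OPEN
exactly on pencils with an invariant class of some degree `4 ≤ 2p ≤ d` NOT in the subring generated by degree 2
(the Weil habitat: `W_K ⊄ ℂ[θ]`; Mumford–Tate-special families), or with a surviving (2,0)-class (isotrivial
factors), and there it is the lift of those excess classes (parts XV-b/c/e). No named fact; `HC_CM` does not occur.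

References: VoisinHodgeII2003 (§9.2.4 Prop. 9.20); DeligneHodgeIII1974 (Cor. 8.2.8); DeligneHodgeII1971 (Cor. 4.1.2,
(4.1.3.1)); Abdulali1994FamiliesAV (Conj. 5.3, Thm. 5.5 p. 1130); Andre1996Motifs (§5.2, §6.3); VoisinHodgeI2002
(§11.3 Thm. 11.30, Prop. 11.20).
-/

noncomputable section

set_option linter.dupNamespace false

namespace Summit.HodgeConjecture.HodgeConjecture.Ring2.AbelianAll

open CategoryTheory AlgebraicGeometry
open Literature.AlgebraicGeometry Literature.AlgebraicGeometry.Motives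
open Literature.AlgebraicGeometry.HodgeTheory
open Literature.AlgebraicTopology.SingularHomology (singularCohomology cupProduct)
open Literature.AlgebraicGeometry.Abdulali1994 (InvariantCyclesHoldFor)

variable {𝒳 S : SchemeOver ℂ}

/-! ## §1 The induction step: (N_p) ∧ (N₁) ∧ generation ⟹ (N_{p+1}) -/

/-- **(N_{p+1})(t₀) from (N_p)(t₀), (N₁)(t₀) and generation of `I_{2(p+1)}(t₀)` by `I_{2p}(t₀) · I₂(t₀)`.** If every
class of `j_{t₀}^* H^{2(p+1)}(𝒳)` is a linear combination of classes `j_{t₀}^*(W ∪ D)` (`W ∈ H²ᵖ(𝒳)`, `D ∈ H²(𝒳)`),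
and the invariant classes of degrees `2p` and `2` at `t₀` are restrictions of algebraic classes, so are those of
degree `2(p+1)`: with algebraic `A`, `B` restricting like `W`, `D`, the class `A ∪ B` is algebraic (cycle × divisor,
the tree's `cupProduct_mem_algebraicClasses_one_right`) and `j^*(A ∪ B) = j^*W ∪ j^*D = j^*(W ∪ D)`.
[cite: VoisinHodgeII2003, §9.2.4 Prop. 9.20] [cite: Abdulali1994FamiliesAV, Theorem 5.5 (p. 1130)] -/
theorem algebraicInvariantClassesAt_succ_of_generated {d : ℕ} {f : 𝒳 ⟶ S} (hf : IsCompactAbelianPencil f d)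
    {t₀ : ComplexPoints S} {p : ℕ} (hNp : AlgebraicInvariantClassesAt hf t₀ p)
    (hN1 : AlgebraicInvariantClassesAt hf t₀ 1)
    (hgen : ∀ W : complexBetti 𝒳 (2 * (p + 1)),
      complexBetti.map (fiberι f t₀) (2 * (p + 1)) W ∈ Submodule.span ℂ
        (Set.range fun x : complexBetti 𝒳 (2 * p) × complexBetti 𝒳 (2 * 1) ↦
          complexBetti.map (fiberι f t₀) (2 * (p + 1))
            (cupProduct (show 2 * p + 2 * 1 = 2 * (p + 1) by ring) x.1 x.2))) :
    AlgebraicInvariantClassesAt hf t₀ (p + 1) := by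
  have h𝒳 := hf.isSmoothProjective_total
  -- the fibre classes which are restrictions of algebraic classes of codimension `p + 1`
  let M : Submodule ℂ (complexBetti (fiberOver f t₀) (2 * (p + 1))) :=
    { carrier := {y | ∃ A ∈ algebraicClasses 𝒳 (p + 1), complexBetti.map (fiberι f t₀) (2 * (p + 1)) A = y}
      zero_mem' := ⟨0, Submodule.zero_mem _, by rw [map_zero]⟩
      add_mem' := by
        rintro y₁ y₂ ⟨A₁, hA₁, rfl⟩ ⟨A₂, hA₂, rfl⟩
        exact ⟨A₁ + A₂, Submodule.add_mem _ hA₁ hA₂, by rw [map_add]⟩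
      smul_mem' := by
        rintro c y ⟨A, hA, rfl⟩
        exact ⟨c • A, Submodule.smul_mem _ c hA, by rw [map_smul]⟩ }
  -- the generators lie in `M`
  have hgenM : Submodule.span ℂ (Set.range fun x : complexBetti 𝒳 (2 * p) × complexBetti 𝒳 (2 * 1) ↦
      complexBetti.map (fiberι f t₀) (2 * (p + 1))
        (cupProduct (show 2 * p + 2 * 1 = 2 * (p + 1) by ring) x.1 x.2)) ≤ M := by
    refine Submodule.span_le.2 ?_
    rintro _ ⟨⟨W, D⟩, rfl⟩
    obtain ⟨A, hA, hAW⟩ := hNp W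
    obtain ⟨B, hB, hBD⟩ := hN1 D
    refine ⟨cupProduct (show 2 * p + 2 * 1 = 2 * (p + 1) by ring) A B,
      cupProduct_mem_algebraicClasses_one_right h𝒳 hA hB, ?_⟩
    change complexBetti.map (fiberι f t₀) (2 * (p + 1)) (cupProduct _ A B) =
      complexBetti.map (fiberι f t₀) (2 * (p + 1)) (cupProduct _ W D)
    rw [complexBetti.map_cupProduct, complexBetti.map_cupProduct, hAW, hBD]
  intro W
  obtain ⟨A, hA, hAW⟩ := hgenM (hgen W)
  exact ⟨A, hA, hAW⟩

/-! ## §2 All degrees by induction; (β′_f) -/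

/-- **(N_p)(t₀) for all `p ≤ P` from (N₁)(t₀) and generation in degrees `4 ≤ 2(p+1) ≤ 2P`** (induction on `p`;
(N₀) holds on every pencil). [cite: Abdulali1994FamiliesAV, Theorem 5.5 (p. 1130)] [cite: VoisinHodgeII2003, §9.2.4 Prop. 9.20] -/
theorem algebraicInvariantClassesAt_of_generated {d : ℕ} {f : 𝒳 ⟶ S} (hf : IsCompactAbelianPencil f d)
    {t₀ : ComplexPoints S} (hN1 : AlgebraicInvariantClassesAt hf t₀ 1) (P : ℕ)
    (hgen : ∀ p : ℕ, 1 ≤ p → p + 1 ≤ P → ∀ W : complexBetti 𝒳 (2 * (p + 1)),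
      complexBetti.map (fiberι f t₀) (2 * (p + 1)) W ∈ Submodule.span ℂ
        (Set.range fun x : complexBetti 𝒳 (2 * p) × complexBetti 𝒳 (2 * 1) ↦
          complexBetti.map (fiberι f t₀) (2 * (p + 1))
            (cupProduct (show 2 * p + 2 * 1 = 2 * (p + 1) by ring) x.1 x.2))) :
    ∀ p ≤ P, AlgebraicInvariantClassesAt hf t₀ p := by
  intro p
  induction p with
  | zero => exact fun _ ↦ algebraicInvariantClassesAt_zero hf t₀
  | succ p ih =>
    intro hp
    rcases Nat.eq_zero_or_pos p with rfl | hpos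
    · exact hN1
    · exact algebraicInvariantClassesAt_succ_of_generated hf (ih (by omega)) hN1 (hgen p hpos hp)

/-- **(β′_f) OUTRIGHT for compact pencils with divisor-spanned invariant `H²` and invariant ring generated in
degree 2 (degrees `≤ d`).** Hypotheses: (N₁)(t₀) (`DivisorSpannedInvariantHTwoAt`) and, for `1 ≤ p` with
`2(p+1) ≤ d`, generation of `I_{2(p+1)}(t₀)` by `I_{2p}(t₀) · I₂(t₀)`; conclusion `FibreClassLefschetzOn hf` by part
XIV-g (`fibreClassLefschetzOn_of_algebraicInvariants_half`: the degrees `2p ≤ d` suffice). No Hodge-conjecture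
input, no named fact, no `HC_CM`. [cite: Abdulali1994FamiliesAV, Conjecture 5.3 and Theorem 5.5 (p. 1130)]
[cite: VoisinHodgeII2003, §9.2.4 Prop. 9.20] -/
theorem fibreClassLefschetzOn_of_generated {d : ℕ} {f : 𝒳 ⟶ S} (hf : IsCompactAbelianPencil f d)
    (t₀ : ComplexPoints S) (hN1 : DivisorSpannedInvariantHTwoAt hf t₀)
    (hgen : ∀ p : ℕ, 1 ≤ p → 2 * (p + 1) ≤ d → ∀ W : complexBetti 𝒳 (2 * (p + 1)),
      complexBetti.map (fiberι f t₀) (2 * (p + 1)) W ∈ Submodule.span ℂ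
        (Set.range fun x : complexBetti 𝒳 (2 * p) × complexBetti 𝒳 (2 * 1) ↦
          complexBetti.map (fiberι f t₀) (2 * (p + 1))
            (cupProduct (show 2 * p + 2 * 1 = 2 * (p + 1) by ring) x.1 x.2))) :
    FibreClassLefschetzOn hf := by
  refine fibreClassLefschetzOn_of_algebraicInvariants_half hf t₀ fun p hp ↦ ?_
  exact algebraicInvariantClassesAt_of_generated hf hN1 (d / 2)
    (fun p' hp' hP W ↦ hgen p' hp' (by omega) W) p (by omega)

/-- **(β′_f) OUTRIGHT for compact pencils with invariant ring generated in degree 2 and NO SURVIVING (2,0)-CLASS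
of the total space** (part XVI-a: `H^{2,0}(𝒳) ⊂ ker j_{t₀}^*` ⟺ (N₁)(t₀)). Generalises part XV-f's rank-one
theorem (`I_{2p} = ℂ·Kᵖ`) to invariant rings generated by several degree-2 classes.
[cite: Abdulali1994FamiliesAV, Conjecture 5.3 (p. 1130)] [cite: DeligneHodgeII1971, (4.1.3.1)] [cite: VoisinHodgeII2003, §9.2.4 Prop. 9.20] -/
theorem fibreClassLefschetzOn_of_generated_of_twoZero_vanish {d : ℕ} {f : 𝒳 ⟶ S} (hf : IsCompactAbelianPencil f d)
    (t₀ : ComplexPoints S)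
    (h20 : ∀ η : complexBetti 𝒳 (2 * 1), IsOfHodgeType (d + 1) 𝒳 (2 * 1) 2 0 η →
      complexBetti.map (fiberι f t₀) (2 * 1) η = 0)
    (hgen : ∀ p : ℕ, 1 ≤ p → 2 * (p + 1) ≤ d → ∀ W : complexBetti 𝒳 (2 * (p + 1)),
      complexBetti.map (fiberι f t₀) (2 * (p + 1)) W ∈ Submodule.span ℂ
        (Set.range fun x : complexBetti 𝒳 (2 * p) × complexBetti 𝒳 (2 * 1) ↦
          complexBetti.map (fiberι f t₀) (2 * (p + 1))
            (cupProduct (show 2 * p + 2 * 1 = 2 * (p + 1) by ring) x.1 x.2))) :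
    FibreClassLefschetzOn hf :=
  fibreClassLefschetzOn_of_generated hf t₀ ((divisorSpannedInvariantHTwoAt_iff_twoZero_vanish hf t₀).2 h20) hgen

/-- The same when the total space has no non-zero class of type (2,0) at all (`h^{2,0}(𝒳) = 0`).
[cite: Abdulali1994FamiliesAV, Conjecture 5.3 (p. 1130)] [cite: VoisinHodgeII2003, §9.2.4 Prop. 9.20] -/
theorem fibreClassLefschetzOn_of_generated_of_twoZero_eq_zero {d : ℕ} {f : 𝒳 ⟶ S} (hf : IsCompactAbelianPencil f d)
    (t₀ : ComplexPoints S) (h20 : ∀ η : complexBetti 𝒳 (2 * 1), IsOfHodgeType (d + 1) 𝒳 (2 * 1) 2 0 η → η = 0)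
    (hgen : ∀ p : ℕ, 1 ≤ p → 2 * (p + 1) ≤ d → ∀ W : complexBetti 𝒳 (2 * (p + 1)),
      complexBetti.map (fiberι f t₀) (2 * (p + 1)) W ∈ Submodule.span ℂ
        (Set.range fun x : complexBetti 𝒳 (2 * p) × complexBetti 𝒳 (2 * 1) ↦
          complexBetti.map (fiberι f t₀) (2 * (p + 1))
            (cupProduct (show 2 * p + 2 * 1 = 2 * (p + 1) by ring) x.1 x.2))) :
    FibreClassLefschetzOn hf :=
  fibreClassLefschetzOn_of_generated_of_twoZero_vanish hf t₀ (fun η hη ↦ by rw [h20 η hη, map_zero]) hgen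

/-- Abdulali's invariant-cycles statement (1.1) for the same pencils (part VIII's engine).
[cite: Abdulali1994FamiliesAV, Theorem 5.5 (p. 1130)] -/
theorem invariantCyclesHoldFor_of_generated_of_twoZero_vanish {d : ℕ} {f : 𝒳 ⟶ S} (hf : IsCompactAbelianPencil f d)
    (t₀ : ComplexPoints S)
    (h20 : ∀ η : complexBetti 𝒳 (2 * 1), IsOfHodgeType (d + 1) 𝒳 (2 * 1) 2 0 η →
      complexBetti.map (fiberι f t₀) (2 * 1) η = 0)
    (hgen : ∀ p : ℕ, 1 ≤ p → 2 * (p + 1) ≤ d → ∀ W : complexBetti 𝒳 (2 * (p + 1)),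
      complexBetti.map (fiberι f t₀) (2 * (p + 1)) W ∈ Submodule.span ℂ
        (Set.range fun x : complexBetti 𝒳 (2 * p) × complexBetti 𝒳 (2 * 1) ↦
          complexBetti.map (fiberι f t₀) (2 * (p + 1))
            (cupProduct (show 2 * p + 2 * 1 = 2 * (p + 1) by ring) x.1 x.2))) :
    InvariantCyclesHoldFor f d :=
  invariantCyclesHoldFor_of_fibreClassLefschetzOn hf (fibreClassLefschetzOn_of_generated_of_twoZero_vanish hf t₀ h20 hgen)

end Summit.HodgeConjecture.HodgeConjecture.Ring2.AbelianAll

end
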